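import Summits.ValiantsHypothesis.ValiantsHypothesis.Theses.BarrierLever
import Summits.ValiantsHypothesis.ValiantsHypothesis.Theorems.BarrierLeverTransversalMinorLayoutsFiniteCheck
import Summits.ValiantsHypothesis.ValiantsHypothesis.Theorems.BarrierLeverTransversalMinorLayoutsRankFive
import Summits.ValiantsHypothesis.ValiantsHypothesis.Theorems.BarrierLeverTransversalMinorLayoutsRankSix
import Summits.ValiantsHypothesis.ValiantsHypothesis.Theorems.BarrierLeverTransversalMinorLayoutsRankSeven
import Summits.ValiantsHypothesis.ValiantsHypothesis.Theorems.BarrierLeverTransversalMinorLayoutsRankEight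
import Summits.ValiantsHypothesis.ValiantsHypothesis.Theorems.BarrierLeverTransversalMinorLayoutsHeightFour
import Summits.ValiantsHypothesis.ValiantsHypothesis.Theorems.BarrierLeverTransversalSufficesForPrincipal
import Summits.ValiantsHypothesis.ValiantsHypothesis.Theorems.BarrierLeverPrincipalMinorLayoutsNonsingularSuffices

/-!
# Route BarrierLever — bounded-rank TT carried down the ladder: TNS (item 19126) and
# `PartitionMinorsHitByVP` (item 19717) for all minors of size `r ≤ R`, today `R = 8`

Helper file (`--supports stmt-ValiantsHypothesis-19717`; cell valiant-natproofs, rung V4, 𝒟-side of door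
(c); seat val-np-p4 gen 9). The cell's ladder TT (19152) ⇒ TNS (19126) ⇒ `PartitionMinorsHitByVP`
(19717) is in the tree as GLOBAL implications (items 19153, 19133, closed); both arrows are in fact
per-layout (`TransversalDictionary.exists_principal_layout_ne_zero`; the `f_K = det(1 + diag(x,y)·K)`
witness of `PrincipalMinorWitness`, via `coeff_pencil_mono` / `det_pencil_mem_smallCircuits`). So every
BOUNDED-RANK slice of TT that the finite-check programme lands (`FiniteCheck.…`, val-np-p1 g8; the
hub/PP certificate files) descends at once:

* `tns_of_tt_rank` — TT for all layouts with `r ≤ R` (every `h`) ⇒ TNS for all layouts with `r ≤ R`;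
* `partitionMinors_hit_of_tns_rank` / `partitionMinors_hit_of_tt_rank` — ⇒ for every `h ≥ 8`, every
  `r × r` MINOR (`r ≤ R`) of Nisan's partition matrix is hit by ONE member of `SmallCircuits ℂ (h+h) 8`
  (the conclusion of item 19717 for these minors, with its constants `b = h₀ = 8`);
* `principalMinorLayouts_nonsingular_of_r_le_four`, `partitionMinors_hit_of_r_le_four` — the case
  `R = 4` from the tree's `FiniteCheck.transversalMinorLayouts_nonsingular_of_r_le_four` (TT for `r ≤ 4`,
  every `h`, landed 2026-08-27);
* `…_of_r_le_five`, `…_of_r_le_six` — the cases `R = 5` and `R = 6` from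
  `FiniteCheck.transversalMinorLayouts_nonsingular_of_r_le_five` / `_of_r_le_six` (val-np-p1 g8's
  `…RankFive` / `…RankSix`, landed 2026-08-27): TNS for every layout with `r ≤ 6` rows at every height,
  and every partition minor of size `≤ 6` hit, `h ≥ 8`;
* `…_of_r_le_seven` — the case `R = 7` from `FiniteCheck.transversalMinorLayouts_nonsingular_of_r_le_seven`
  (val-np-p1 g8's `…RankSeven`, landed 2026-08-27): TNS for `r ≤ 7` rows at every height, every partition
  minor of size `≤ 7` hit, `h ≥ 8`.

* `…_of_r_le_eight` — the case `R = 8` from `FiniteCheck.transversalMinorLayouts_nonsingular_of_r_le_eight`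
  (val-np-p1 g8's `…RankEight`, item 19933 `TransversalLayoutsRankLeEight`, closed 2026-08-27): TNS for
  `r ≤ 8` rows at every height, every partition minor of size `≤ 8` hit, `h ≥ 8`;
* `principalMinorLayouts_nonsingular_of_h_le_four` — the HEIGHT slice: TNS for every layout of height
  `h ≤ 4`, every `r`, from `FiniteCheck.transversalMinorLayouts_nonsingular_of_h_le_four` (val-np-p4 g10's
  `…HeightFour`, landed 2026-08-27) — item 19717 needs `h ≥ 8`, so this slice descends to TNS only.

WHAT THIS IS NOT: TT / TNS are REFUTED in general (val-np-p3 g4, `TNSRefutation`, first dead instance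
`(h, r) = (15, 16)`) — these are TRUE FINITE SLICES; item 19717 is NOT proved (open from `r = 9` on —
`R` is a parameter, so the next rung descends by one `exact`); nothing on crux
stmt-ValiantsHypothesis-14610 or on `VP` versus `VNP`.
-/

-- layout Summits/ValiantsHypothesis/ValiantsHypothesis forces the duplicated namespace component
set_option linter.dupNamespace false

namespace Summit.ValiantsHypothesis.ValiantsHypothesis.Theorems.BarrierLever.BoundedRank

open MvPolynomial Literature.Barriers.ValiantsHypothesis

/-- **TT for `r ≤ R` ⇒ TNS for `r ≤ R`** (per-layout dictionary of item 19153). -/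
theorem tns_of_tt_rank (R : ℕ)
    (hTT : ∀ (h r : ℕ), r ≤ R → ∀ (u w : Fin r → Finset (Fin h)), Function.Injective u →
      Function.Injective w →
      ∃ H : Matrix (Fin (h + h)) (Fin (h + h)) ℂ, (Matrix.of fun i j : Fin r => (H.submatrix
        (fun a : Fin h => if a ∈ u i then Fin.castAdd h a else Fin.natAdd h a)
        (fun c : Fin h => if c ∈ w j then Fin.natAdd h c else Fin.castAdd h c)).det).det ≠ 0)
    (h r : ℕ) (hr : r ≤ R) (u w : Fin r → Finset (Fin h)) (hu : Function.Injective u)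
    (hw : Function.Injective w) :
    ∃ K : Matrix (Fin (h + h)) (Fin (h + h)) ℂ, (Matrix.of fun i j : Fin r => (K.submatrix
      (Subtype.val :
        ↥((u i).map (Fin.castAddEmb h) ∪ (w j).map (Fin.natAddEmb h)) → Fin (h + h))
      (Subtype.val : ↥((u i).map (Fin.castAddEmb h) ∪ (w j).map (Fin.natAddEmb h)) →
        Fin (h + h))).det).det ≠ 0 :=
  TransversalDictionary.exists_principal_layout_ne_zero u w (hTT h r hr u w hu hw)

/-- **TNS for `r ≤ R` ⇒ every `r × r` partition minor (`r ≤ R`, `h ≥ 8`) is hit by one member of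
`SmallCircuits ℂ (h+h) 8`** (the universal witness `f_K = det(1 + diag(x,y)·K)` of item 19133, per
layout). -/
theorem partitionMinors_hit_of_tns_rank (R : ℕ)
    (hTNS : ∀ (h r : ℕ), r ≤ R → ∀ (u w : Fin r → Finset (Fin h)), Function.Injective u →
      Function.Injective w →
      ∃ K : Matrix (Fin (h + h)) (Fin (h + h)) ℂ, (Matrix.of fun i j : Fin r => (K.submatrix
        (Subtype.val :
          ↥((u i).map (Fin.castAddEmb h) ∪ (w j).map (Fin.natAddEmb h)) → Fin (h + h))
        (Subtype.val : ↥((u i).map (Fin.castAddEmb h) ∪ (w j).map (Fin.natAddEmb h)) →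
          Fin (h + h))).det).det ≠ 0)
    (h : ℕ) (hh : 8 ≤ h) (r : ℕ) (hr : r ≤ R) (u w : Fin r → Finset (Fin h))
    (hu : Function.Injective u) (hw : Function.Injective w) :
    ∃ f ∈ SmallCircuits ℂ (h + h) 8, (Matrix.of fun i j : Fin r => MvPolynomial.coeff
      (∑ a ∈ u i, Finsupp.single (Fin.castAdd h a) 1 + ∑ c ∈ w j, Finsupp.single (Fin.natAdd h c) 1)
        f).det ≠ 0 := by
  obtain ⟨K, hK⟩ := hTNS h r hr u w hu hw
  refine ⟨(1 + Matrix.diagonal (fun i : Fin (h + h) => (X i : MvPolynomial (Fin (h + h)) ℂ)) *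
      K.map C : Matrix (Fin (h + h)) (Fin (h + h)) (MvPolynomial (Fin (h + h)) ℂ)).det,
    PrincipalMinorWitness.det_pencil_mem_smallCircuits hh K, ?_⟩
  have hmat : (Matrix.of fun i j : Fin r => MvPolynomial.coeff
        (∑ a ∈ u i, Finsupp.single (Fin.castAdd h a) 1 + ∑ c ∈ w j, Finsupp.single (Fin.natAdd h c) 1)
        (1 + Matrix.diagonal (fun i : Fin (h + h) => (X i : MvPolynomial (Fin (h + h)) ℂ)) * K.map C :
      Matrix (Fin (h + h)) (Fin (h + h)) (MvPolynomial (Fin (h + h)) ℂ)).det)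
      = Matrix.of fun i j : Fin r =>
        (K.submatrix
          (Subtype.val : ↥((u i).map (Fin.castAddEmb h) ∪ (w j).map (Fin.natAddEmb h)) → Fin (h + h))
          (Subtype.val :
            ↥((u i).map (Fin.castAddEmb h) ∪ (w j).map (Fin.natAddEmb h)) → Fin (h + h))).det := by
    ext i j
    simp only [Matrix.of_apply]
    exact PrincipalMinorWitness.coeff_pencil_mono h K (u i) (w j)
  rw [hmat]
  exact hK

/-- **TT for `r ≤ R` ⇒ every `r × r` partition minor (`r ≤ R`, `h ≥ 8`) is hit by one member of
`SmallCircuits ℂ (h+h) 8`.** -/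
theorem partitionMinors_hit_of_tt_rank (R : ℕ)
    (hTT : ∀ (h r : ℕ), r ≤ R → ∀ (u w : Fin r → Finset (Fin h)), Function.Injective u →
      Function.Injective w →
      ∃ H : Matrix (Fin (h + h)) (Fin (h + h)) ℂ, (Matrix.of fun i j : Fin r => (H.submatrix
        (fun a : Fin h => if a ∈ u i then Fin.castAdd h a else Fin.natAdd h a)
        (fun c : Fin h => if c ∈ w j then Fin.natAdd h c else Fin.castAdd h c)).det).det ≠ 0)
    (h : ℕ) (hh : 8 ≤ h) (r : ℕ) (hr : r ≤ R) (u w : Fin r → Finset (Fin h))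
    (hu : Function.Injective u) (hw : Function.Injective w) :
    ∃ f ∈ SmallCircuits ℂ (h + h) 8, (Matrix.of fun i j : Fin r => MvPolynomial.coeff
      (∑ a ∈ u i, Finsupp.single (Fin.castAdd h a) 1 + ∑ c ∈ w j, Finsupp.single (Fin.natAdd h c) 1)
        f).det ≠ 0 :=
  partitionMinors_hit_of_tns_rank R (tns_of_tt_rank R hTT) h hh r hr u w hu hw

/-! ## The case `R = 4` -/

/-- **TNS (item 19126) for all layouts with `r ≤ 4`, every `h`.** -/
theorem principalMinorLayouts_nonsingular_of_r_le_four (h r : ℕ) (hr : r ≤ 4)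
    (u w : Fin r → Finset (Fin h)) (hu : Function.Injective u) (hw : Function.Injective w) :
    ∃ K : Matrix (Fin (h + h)) (Fin (h + h)) ℂ, (Matrix.of fun i j : Fin r => (K.submatrix
      (Subtype.val :
        ↥((u i).map (Fin.castAddEmb h) ∪ (w j).map (Fin.natAddEmb h)) → Fin (h + h))
      (Subtype.val : ↥((u i).map (Fin.castAddEmb h) ∪ (w j).map (Fin.natAddEmb h)) →
        Fin (h + h))).det).det ≠ 0 :=
  tns_of_tt_rank 4 (fun h' r' hr' u' w' hu' hw' =>
    FiniteCheck.transversalMinorLayouts_nonsingular_of_r_le_four h' r' hr' u' w' hu' hw') h r hr u w hu hw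

/-- **Item 19717 for minors of size `r ≤ 4`**: for every `h ≥ 8` and every injective layout with
`r ≤ 4`, one `f ∈ SmallCircuits ℂ (h+h) 8` has a nonzero `r × r` partition-matrix minor there. -/
theorem partitionMinors_hit_of_r_le_four (h : ℕ) (hh : 8 ≤ h) (r : ℕ) (hr : r ≤ 4)
    (u w : Fin r → Finset (Fin h)) (hu : Function.Injective u) (hw : Function.Injective w) :
    ∃ f ∈ SmallCircuits ℂ (h + h) 8, (Matrix.of fun i j : Fin r => MvPolynomial.coeff
      (∑ a ∈ u i, Finsupp.single (Fin.castAdd h a) 1 + ∑ c ∈ w j, Finsupp.single (Fin.natAdd h c) 1)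
        f).det ≠ 0 :=
  partitionMinors_hit_of_tt_rank 4 (fun h' r' hr' u' w' hu' hw' =>
    FiniteCheck.transversalMinorLayouts_nonsingular_of_r_le_four h' r' hr' u' w' hu' hw')
    h hh r hr u w hu hw

/-! ## The case `R = 5` (val-np-p1 g8's `FiniteCheck.transversalMinorLayouts_nonsingular_of_r_le_five`) -/

/-- **TNS (item 19126) for all layouts with `r ≤ 5`, every `h`.** -/
theorem principalMinorLayouts_nonsingular_of_r_le_five (h r : ℕ) (hr : r ≤ 5)
    (u w : Fin r → Finset (Fin h)) (hu : Function.Injective u) (hw : Function.Injective w) :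
    ∃ K : Matrix (Fin (h + h)) (Fin (h + h)) ℂ, (Matrix.of fun i j : Fin r => (K.submatrix
      (Subtype.val :
        ↥((u i).map (Fin.castAddEmb h) ∪ (w j).map (Fin.natAddEmb h)) → Fin (h + h))
      (Subtype.val : ↥((u i).map (Fin.castAddEmb h) ∪ (w j).map (Fin.natAddEmb h)) →
        Fin (h + h))).det).det ≠ 0 :=
  tns_of_tt_rank 5 (fun h' r' hr' u' w' hu' hw' =>
    FiniteCheck.transversalMinorLayouts_nonsingular_of_r_le_five h' r' hr' u' w' hu' hw') h r hr u w hu hw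

/-- **Item 19717 for minors of size `r ≤ 5`**: for every `h ≥ 8` and every injective layout with
`r ≤ 5`, one `f ∈ SmallCircuits ℂ (h+h) 8` has a nonzero `r × r` partition-matrix minor there. -/
theorem partitionMinors_hit_of_r_le_five (h : ℕ) (hh : 8 ≤ h) (r : ℕ) (hr : r ≤ 5)
    (u w : Fin r → Finset (Fin h)) (hu : Function.Injective u) (hw : Function.Injective w) :
    ∃ f ∈ SmallCircuits ℂ (h + h) 8, (Matrix.of fun i j : Fin r => MvPolynomial.coeff
      (∑ a ∈ u i, Finsupp.single (Fin.castAdd h a) 1 + ∑ c ∈ w j, Finsupp.single (Fin.natAdd h c) 1)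
        f).det ≠ 0 :=
  partitionMinors_hit_of_tt_rank 5 (fun h' r' hr' u' w' hu' hw' =>
    FiniteCheck.transversalMinorLayouts_nonsingular_of_r_le_five h' r' hr' u' w' hu' hw')
    h hh r hr u w hu hw

/-! ## The case `R = 6` (val-np-p1 g8's `FiniteCheck.transversalMinorLayouts_nonsingular_of_r_le_six`) -/

/-- **TNS (item 19126) for all layouts with `r ≤ 6`, every `h`.** -/
theorem principalMinorLayouts_nonsingular_of_r_le_six (h r : ℕ) (hr : r ≤ 6)
    (u w : Fin r → Finset (Fin h)) (hu : Function.Injective u) (hw : Function.Injective w) :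
    ∃ K : Matrix (Fin (h + h)) (Fin (h + h)) ℂ, (Matrix.of fun i j : Fin r => (K.submatrix
      (Subtype.val :
        ↥((u i).map (Fin.castAddEmb h) ∪ (w j).map (Fin.natAddEmb h)) → Fin (h + h))
      (Subtype.val : ↥((u i).map (Fin.castAddEmb h) ∪ (w j).map (Fin.natAddEmb h)) →
        Fin (h + h))).det).det ≠ 0 :=
  tns_of_tt_rank 6 (fun h' r' hr' u' w' hu' hw' =>
    FiniteCheck.transversalMinorLayouts_nonsingular_of_r_le_six h' r' hr' u' w' hu' hw') h r hr u w hu hw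

/-- **Item 19717 for minors of size `r ≤ 6`**: for every `h ≥ 8` and every injective layout with
`r ≤ 6`, one `f ∈ SmallCircuits ℂ (h+h) 8` has a nonzero `r × r` partition-matrix minor there. -/
theorem partitionMinors_hit_of_r_le_six (h : ℕ) (hh : 8 ≤ h) (r : ℕ) (hr : r ≤ 6)
    (u w : Fin r → Finset (Fin h)) (hu : Function.Injective u) (hw : Function.Injective w) :
    ∃ f ∈ SmallCircuits ℂ (h + h) 8, (Matrix.of fun i j : Fin r => MvPolynomial.coeff
      (∑ a ∈ u i, Finsupp.single (Fin.castAdd h a) 1 + ∑ c ∈ w j, Finsupp.single (Fin.natAdd h c) 1)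
        f).det ≠ 0 :=
  partitionMinors_hit_of_tt_rank 6 (fun h' r' hr' u' w' hu' hw' =>
    FiniteCheck.transversalMinorLayouts_nonsingular_of_r_le_six h' r' hr' u' w' hu' hw')
    h hh r hr u w hu hw

/-! ## The case `R = 7` (val-np-p1 g8's `FiniteCheck.transversalMinorLayouts_nonsingular_of_r_le_seven`) -/

/-- **TNS (item 19126) for all layouts with `r ≤ 7`, every `h`.** -/
theorem principalMinorLayouts_nonsingular_of_r_le_seven (h r : ℕ) (hr : r ≤ 7)
    (u w : Fin r → Finset (Fin h)) (hu : Function.Injective u) (hw : Function.Injective w) :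
    ∃ K : Matrix (Fin (h + h)) (Fin (h + h)) ℂ, (Matrix.of fun i j : Fin r => (K.submatrix
      (Subtype.val :
        ↥((u i).map (Fin.castAddEmb h) ∪ (w j).map (Fin.natAddEmb h)) → Fin (h + h))
      (Subtype.val : ↥((u i).map (Fin.castAddEmb h) ∪ (w j).map (Fin.natAddEmb h)) →
        Fin (h + h))).det).det ≠ 0 :=
  tns_of_tt_rank 7 (fun h' r' hr' u' w' hu' hw' =>
    FiniteCheck.transversalMinorLayouts_nonsingular_of_r_le_seven h' r' hr' u' w' hu' hw') h r hr u w hu hw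

/-- **Item 19717 for minors of size `r ≤ 7`**: for every `h ≥ 8` and every injective layout with
`r ≤ 7`, one `f ∈ SmallCircuits ℂ (h+h) 8` has a nonzero `r × r` partition-matrix minor there. -/
theorem partitionMinors_hit_of_r_le_seven (h : ℕ) (hh : 8 ≤ h) (r : ℕ) (hr : r ≤ 7)
    (u w : Fin r → Finset (Fin h)) (hu : Function.Injective u) (hw : Function.Injective w) :
    ∃ f ∈ SmallCircuits ℂ (h + h) 8, (Matrix.of fun i j : Fin r => MvPolynomial.coeff
      (∑ a ∈ u i, Finsupp.single (Fin.castAdd h a) 1 + ∑ c ∈ w j, Finsupp.single (Fin.natAdd h c) 1)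
        f).det ≠ 0 :=
  partitionMinors_hit_of_tt_rank 7 (fun h' r' hr' u' w' hu' hw' =>
    FiniteCheck.transversalMinorLayouts_nonsingular_of_r_le_seven h' r' hr' u' w' hu' hw')
    h hh r hr u w hu hw

/-! ## The height slice `h ≤ 4`, every `r` (val-np-p4 g10's `FiniteCheck.transversalMinorLayouts_nonsingular_of_h_le_four`) -/

/-- **TNS (item 19126) for every layout of height `h ≤ 4`, every `r`** (per-layout dictionary of item
19153 applied to the height slice of TT). -/
theorem principalMinorLayouts_nonsingular_of_h_le_four (h r : ℕ) (hh : h ≤ 4)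
    (u w : Fin r → Finset (Fin h)) (hu : Function.Injective u) (hw : Function.Injective w) :
    ∃ K : Matrix (Fin (h + h)) (Fin (h + h)) ℂ, (Matrix.of fun i j : Fin r => (K.submatrix
      (Subtype.val :
        ↥((u i).map (Fin.castAddEmb h) ∪ (w j).map (Fin.natAddEmb h)) → Fin (h + h))
      (Subtype.val : ↥((u i).map (Fin.castAddEmb h) ∪ (w j).map (Fin.natAddEmb h)) →
        Fin (h + h))).det).det ≠ 0 :=
  TransversalDictionary.exists_principal_layout_ne_zero u w
    (FiniteCheck.transversalMinorLayouts_nonsingular_of_h_le_four h r hh u w hu hw)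

/-! ## The case `R = 8` (val-np-p1 g8's `FiniteCheck.transversalMinorLayouts_nonsingular_of_r_le_eight`, item 19933) -/

/-- **TNS for all layouts with `r ≤ 8`, every `h`** (a true finite slice; TNS in general is refuted). -/
theorem principalMinorLayouts_nonsingular_of_r_le_eight (h r : ℕ) (hr : r ≤ 8)
    (u w : Fin r → Finset (Fin h)) (hu : Function.Injective u) (hw : Function.Injective w) :
    ∃ K : Matrix (Fin (h + h)) (Fin (h + h)) ℂ, (Matrix.of fun i j : Fin r => (K.submatrix
      (Subtype.val :
        ↥((u i).map (Fin.castAddEmb h) ∪ (w j).map (Fin.natAddEmb h)) → Fin (h + h))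
      (Subtype.val : ↥((u i).map (Fin.castAddEmb h) ∪ (w j).map (Fin.natAddEmb h)) →
        Fin (h + h))).det).det ≠ 0 :=
  tns_of_tt_rank 8 (fun h' r' hr' u' w' hu' hw' =>
    FiniteCheck.transversalMinorLayouts_nonsingular_of_r_le_eight h' r' hr' u' w' hu' hw') h r hr u w hu hw

/-- **Item 19717 for minors of size `r ≤ 8`**: for every `h ≥ 8` and every injective layout with
`r ≤ 8`, one `f ∈ SmallCircuits ℂ (h+h) 8` has a nonzero `r × r` partition-matrix minor there. -/
theorem partitionMinors_hit_of_r_le_eight (h : ℕ) (hh : 8 ≤ h) (r : ℕ) (hr : r ≤ 8)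
    (u w : Fin r → Finset (Fin h)) (hu : Function.Injective u) (hw : Function.Injective w) :
    ∃ f ∈ SmallCircuits ℂ (h + h) 8, (Matrix.of fun i j : Fin r => MvPolynomial.coeff
      (∑ a ∈ u i, Finsupp.single (Fin.castAdd h a) 1 + ∑ c ∈ w j, Finsupp.single (Fin.natAdd h c) 1)
        f).det ≠ 0 :=
  partitionMinors_hit_of_tt_rank 8 (fun h' r' hr' u' w' hu' hw' =>
    FiniteCheck.transversalMinorLayouts_nonsingular_of_r_le_eight h' r' hr' u' w' hu' hw')
    h hh r hr u w hu hw

end Summit.ValiantsHypothesis.ValiantsHypothesis.Theorems.BarrierLever.BoundedRank
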